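import Summits.QuantumFields.YangMills.Theorems.UnitScaleTiltProp7LocMinOfPinnedChartSlice
import Literature.MathematicalPhysics.QuantumFieldTheory.Balaban1983to89.B15DeterminingSets
import HarnessLib

/-!
# Route `UnitScaleTilt`, crux K1 child «MinimiserStabilityRegPr» (stmt-QuantumFields-19200) — E′'S GROWTH SIDE AFTER THE ORBIT TEST:
# E′ ⇐ (E1) «PINNED SLICE THEOREM» (per competitor an EXACTLY `S_H`-gauged fibre point with the competitor's action and an `s_Q·ℓ⁻¹` chart)
#    ∧ (S3) the curved ζ-row ON EXACTLY `S_H`-GAUGED FIBRE POINTS — the two displayed rows of route-R's E′ after 2026-08-28 20:35Z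

Cell `ym3-torus` ∕ fleet seat `ym-ust-19200-p1` (gen 15, route-R E′ lead ∕ namer).  THEOREMS ONLY (0 `def`, 0 `sorry`); `--supports stmt-QuantumFields-19200`,
count-neutral.  YM₃ on T³ is a ladder rung (R3), not the Clay problem; nothing here claims the stub, the crux, d = 4 or the mass gap; E′ is NOT closed by this file.

WHY (bus 2026-08-28: ym3-torus-px15 g2 ORBIT TEST 20:32Z, ★p1 g15 verdict «CONFIRMED» + proposal (E1) 20:35Z, ★★OWNER ACK 79).  The (α′) knit ✓`Prop7PV3EOfCorrectorRows`
instantiates the gauge-free door ✓`Prop7LocMinOfPinnedChartSlice.stub_PV3E_of_fibrePointSlice` with a ONE-STEP linear `S_H` corrector; on the pinned gauge orbit of the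
background (competitors `(W e^{t})^{w}`, `w` pinned) that recipe returns a fibre point with a NONZERO pinned pure-gauge residual `O(h²)`, for which the door's slice row
`DIV ≤ ζK + δ₁ℓ⁻²M` is false (`DIV ≥ 4ℓ⁻¹·ℓ⁻²M` by the pinned gap, `K = O(a²)`).  Hence the representative must be EXACTLY `S_H`-gauged: the corrector iterated to its fixed point
= a nonlinear gauge fixing inside the pinned group (4) — row (E1) — after which the BCH remainder `R` of the knit vanishes and the only analytic row left is the ζ-row on exactly
`S_H`-gauged fibre points — row (S3), numerically certified on `S_H ∩ ker Q_W` (NUMERICS-19200-S3-CURVED-g15: `ζ_SH ≤ 0.2`, `θ_M(ζ₁=1) < 0`, `κ_K ≥ 7.2` at ℓ = 3,5,9).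
This file is the bookkeeping: E′ ⇐ (E1) ∧ (S3), both DISPLAYED in the door's letters with the `S_H` condition written as
`Δ_W(D*_W(iD))(x) = 0` for `x ∉ range (embIter (K−n))` (`Δ_W := divB ∘ covD`, the letters of ✓`Prop7CentreHarmonicRegaugeSupCov.covLap_divB_regaugeCov_eq_zero_off`).

WHAT IS PROVED (ns `…Theorems.Prop7PV3EOfPinnedSliceAndZetaRow`): ★★★ `stub_PV3E_of_pinnedSliceAndZetaRow`.
HONEST SCOPE.  Composition over ✓`stub_PV3E_of_fibrePointSlice`; rows (E1) (pen: route-R corrector lineage) and (S3) (K-form engine, DESIGN-S3-KFORM-ENGINE-g15) are OPEN and displayed;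
constants `e₆ sQ ζ δ₁` and their windows are those of the door verbatim (chosen last, by the namer).

References: T. Bałaban, CMP 102 (1985) 277–309 [Balaban1985Variational] ((4)–(7) p.278, (14)–(15) p.280, (116) p.295, (141)–(143), Prop. 7 p.299);
CMP 99 (1985) 389–434 [Balaban1985BackgroundPropagators] ((3.8)–(3.11) p.392, Thm 3.11 p.416); CMP 99 (1985) 75–102 [Balaban1985RegularSpaces] ((1.14) p.78, Thm 2 p.83).
-/

set_option autoImplicit false
noncomputable section

open scoped BigOperators Matrix.Norms.L2Operator Matrix

namespace Summit.QuantumFields.YangMills.Theorems.Prop7PV3EOfPinnedSliceAndZetaRow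

open Literature.MathematicalPhysics.QuantumFieldTheory.Balaban1983to89
open Literature.MathematicalPhysics.QuantumFieldTheory.Balaban1983to89.T3ContinuumYM3Torus
open Literature.MathematicalPhysics.QuantumFieldTheory.Balaban1983to89.T3Thm1Carrier
open Literature.MathematicalPhysics.QuantumFieldTheory.Balaban1983to89.T3PrintedRegularMinimiser
open Literature.MathematicalPhysics.QuantumFieldTheory.Balaban1983to89.T3RegularMinimiser
open Literature.MathematicalPhysics.QuantumFieldTheory.Balaban1983to89.T3Thm1CarrierNative (IsCritR2)
open Literature.MathematicalPhysics.QuantumFieldTheory.Balaban1983to89.T3SectALandauChart (CloseAvg)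
open T4Continuum
open MatrixLog (mlog)
open B9Eq39Adjoint (divB covD)
open B10Eq27TorusAxialLog (unitsField toUField)
open B9TorusCalculus (torusT)
open B15DeterminingSets (embIter)
open Summit.QuantumFields.YangMills.Theorems.Prop7LocMinOfPinnedChartSlice (stub_PV3E_of_fibrePointSlice)

set_option maxHeartbeats 800000 in
/-- ★★★ **E′ ⇐ (E1) PINNED SLICE THEOREM ∧ (S3) THE ζ-ROW ON EXACTLY `S_H`-GAUGED FIBRE POINTS.**  For every `L > 1` constants `e₆ sQ ζ δ₁` with the windows of
✓`stub_PV3E_of_fibrePointSlice`, and at every member, radius `0 < e ≤ e₆`, datum `V`, R2-critical `W ∈ (6)(e) ∩ 𝔅_k(V)`: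
(E1) every competitor `W′ ∈ (6)(e) ∩ 𝔅_k(V)` has a fibre point `Y ∈ (6)(e) ∩ 𝔅_k(V)` with `A(W′) = A(Y)`, `‖Y_bW_b⁻¹ − 1‖ ≤ sQ·ℓ⁻¹`, whose chart `D = −i log(Y_bW_b⁻¹)` is EXACTLY
`S_H`-gauged: `Δ_W(D*_W(iD))(x) = 0` for every site `x` off `range (embIter (K−n))`;
(S3) every fibre point `Y ∈ (6)(e) ∩ 𝔅_k(V)` with that sup chart and that `S_H` condition satisfies `DIV_W(D) ≤ ζ·K_W(D) + δ₁ℓ⁻²Σ‖D‖²`.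
CONCLUSION = the E′ text verbatim. [cite: Balaban1985Variational, (141)-(143) p.299, Prop. 7 p.299, (4)-(7) p.278, (116) p.295; Balaban1985BackgroundPropagators, (3.8)-(3.11) p.392; Balaban1985RegularSpaces, (1.14) p.78, Thm 2 p.83] -/
theorem stub_PV3E_of_pinnedSliceAndZetaRow
    (hrows : ∀ (L : ℕ), 1 < L → ∃ e₆ sQ ζ δ₁ : ℝ, 0 < e₆ ∧ 100000000000000 * (L : ℝ) ^ 9 * e₆ ≤ 1 ∧ 0 ≤ sQ ∧ 8 * sQ ≤ 1 ∧
      800000000000 * (L : ℝ) ^ 9 * sQ ≤ 1 ∧ 0 ≤ ζ ∧ 0 ≤ δ₁ ∧ δ₁ < 4 * (1 / (128 * (18 + 537600 * (L : ℝ) ^ 4))) ∧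
      16 * e₆ * ((8 * ((3 / 2) * (694800 * (L : ℝ) ^ 5) * (28800 * (L : ℝ) ^ 4) * ((L : ℝ) ^ 2 / ((L : ℝ) ^ 3 - 1)))) * (1 + ζ)) ≤ 1 ∧
      15552 * (2 * sQ) ^ 2 + 216 * e₆ + 2 * e₆ * ((2 * ((3 / 2) * (694800 * (L : ℝ) ^ 5) * (7 * ((L : ℝ) ^ 2 / ((L : ℝ) - 1)) + 600000 * (L : ℝ) ^ 4 * ((L : ℝ) ^ 2 / ((L : ℝ) ^ 3 - 1)))) + 322608 * ((3 / 2) * (694800 * (L : ℝ) ^ 5) * (28800 * (L : ℝ) ^ 4) * ((L : ℝ) ^ 2 / ((L : ℝ) ^ 3 - 1))))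
        + (8 * ((3 / 2) * (694800 * (L : ℝ) ^ 5) * (28800 * (L : ℝ) ^ 4) * ((L : ℝ) ^ 2 / ((L : ℝ) ^ 3 - 1)))) * δ₁)
        ≤ (((1 / (128 * (18 + 537600 * (L : ℝ) ^ 4))) - δ₁ / 4) / (1 + ζ / 4)) / 8 ∧
      -- (E1) the pinned slice theorem: an exactly S_H-gauged fibre point per competitor
      (∀ (F : T3Family), F.L = L → ∀ (n K : ℕ) (hnK : n < K) (e : ℝ) (V : GaugeField (F.P n) 0 (Matrix.specialUnitaryGroup (Fin 2) ℂ))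
        (W : GaugeField (F.P K) 0 (Matrix.specialUnitaryGroup (Fin 2) ℂ)),
        0 < e → e ≤ e₆ → W ∈ regFibrePr F n K hnK.le e V → IsCritR2 F n K hnK.le V W →
        ∀ W' : GaugeField (F.P K) 0 (Matrix.specialUnitaryGroup (Fin 2) ℂ), W' ∈ regFibrePr F n K hnK.le e V →
          ∃ Y : GaugeField (F.P K) 0 (Matrix.specialUnitaryGroup (Fin 2) ℂ), Y ∈ regFibrePr F n K hnK.le e V ∧ wilsonAction4 W' = wilsonAction4 Y ∧
            (∀ b : PBond (F.P K) 0, ‖((Y b * (W b)⁻¹ : Matrix.specialUnitaryGroup (Fin 2) ℂ) : Matrix (Fin 2) (Fin 2) ℂ) - 1‖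
              ≤ sQ * ((F.L : ℝ) ^ (K - n))⁻¹) ∧
            (∀ x : Site (F.P K) 0, x ∉ Set.range (embIter (K - n)) →
              divB (torusT (F.P K) 0) (fun κ z => unitsField (toUField W) ⟨z, κ⟩)
                (fun μ z => covD (torusT (F.P K) 0) (fun κ z => unitsField (toUField W) ⟨z, κ⟩) μ
                  (fun y => divB (torusT (F.P K) 0) (fun κ z => unitsField (toUField W) ⟨z, κ⟩)
                    (fun κ z => Complex.I • ((-Complex.I) • mlog ((Y ⟨z, κ⟩ * (W ⟨z, κ⟩)⁻¹ : Matrix.specialUnitaryGroup (Fin 2) ℂ) : Matrix (Fin 2) (Fin 2) ℂ))) y) z) x = 0)) ∧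
      -- (S3) the curved ζ-row on exactly S_H-gauged fibre points with the sup chart
      (∀ (F : T3Family), F.L = L → ∀ (n K : ℕ) (hnK : n < K) (e : ℝ) (V : GaugeField (F.P n) 0 (Matrix.specialUnitaryGroup (Fin 2) ℂ))
        (W : GaugeField (F.P K) 0 (Matrix.specialUnitaryGroup (Fin 2) ℂ)),
        0 < e → e ≤ e₆ → W ∈ regFibrePr F n K hnK.le e V → IsCritR2 F n K hnK.le V W →
        ∀ Y : GaugeField (F.P K) 0 (Matrix.specialUnitaryGroup (Fin 2) ℂ), Y ∈ regFibrePr F n K hnK.le e V →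
          (∀ b : PBond (F.P K) 0, ‖((Y b * (W b)⁻¹ : Matrix.specialUnitaryGroup (Fin 2) ℂ) : Matrix (Fin 2) (Fin 2) ℂ) - 1‖
              ≤ sQ * ((F.L : ℝ) ^ (K - n))⁻¹) →
          (∀ x : Site (F.P K) 0, x ∉ Set.range (embIter (K - n)) →
              divB (torusT (F.P K) 0) (fun κ z => unitsField (toUField W) ⟨z, κ⟩)
                (fun μ z => covD (torusT (F.P K) 0) (fun κ z => unitsField (toUField W) ⟨z, κ⟩) μ
                  (fun y => divB (torusT (F.P K) 0) (fun κ z => unitsField (toUField W) ⟨z, κ⟩)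
                    (fun κ z => Complex.I • ((-Complex.I) • mlog ((Y ⟨z, κ⟩ * (W ⟨z, κ⟩)⁻¹ : Matrix.specialUnitaryGroup (Fin 2) ℂ) : Matrix (Fin 2) (Fin 2) ℂ))) y) z) x = 0) →
          ∀ D : PBond (F.P K) 0 → Matrix (Fin 2) (Fin 2) ℂ,
            D = (fun b => (-Complex.I) • mlog ((Y b * (W b)⁻¹ : Matrix.specialUnitaryGroup (Fin 2) ℂ) : Matrix (Fin 2) (Fin 2) ℂ)) →
            (∑ x : Site (F.P K) 0, ∑ j : Fin 2, ∑ k : Fin 2,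
              ‖(divB (torusT (F.P K) 0) (fun κ z => unitsField (toUField W) ⟨z, κ⟩) (fun κ z => Complex.I • D ⟨z, κ⟩) x) j k‖ ^ 2)
              ≤ ζ * (∑ p : Plaq (F.P K) 0, ‖((Complex.I • D ⟨p.src, p.μ⟩) + ((W ⟨p.src, p.μ⟩ : Matrix (Fin 2) (Fin 2) ℂ) * (Complex.I • D ⟨p.src.shift p.μ, p.ν⟩) * star (W ⟨p.src, p.μ⟩ : Matrix (Fin 2) (Fin 2) ℂ))
            - (((W ⟨p.src, p.μ⟩ * W ⟨p.src.shift p.μ, p.ν⟩ * (W ⟨p.src.shift p.ν, p.μ⟩)⁻¹ : Matrix.specialUnitaryGroup (Fin 2) ℂ) : Matrix (Fin 2) (Fin 2) ℂ) * (Complex.I • D ⟨p.src.shift p.ν, p.μ⟩) * star ((W ⟨p.src, p.μ⟩ * W ⟨p.src.shift p.μ, p.ν⟩ * (W ⟨p.src.shift p.ν, p.μ⟩)⁻¹ : Matrix.specialUnitaryGroup (Fin 2) ℂ) : Matrix (Fin 2) (Fin 2) ℂ))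
            - (((GaugeField.plaqHol W p : Matrix.specialUnitaryGroup (Fin 2) ℂ) : Matrix (Fin 2) (Fin 2) ℂ) * (Complex.I • D ⟨p.src, p.ν⟩) * star ((GaugeField.plaqHol W p : Matrix.specialUnitaryGroup (Fin 2) ℂ) : Matrix (Fin 2) (Fin 2) ℂ)))‖ ^ 2)
                + δ₁ * (((F.L : ℝ) ^ (K - n)) ^ 2)⁻¹ * ∑ b : PBond (F.P K) 0, ‖D b‖ ^ 2)) :
    ∀ (L : ℕ), 1 < L → ∀ (B₃ : ℝ), 4 < B₃ →
    ∃ e₅ a₁'' : ℝ, 0 < e₅ ∧ 0 < a₁'' ∧ ∀ (i : Idx L) (e ε₁ : ℝ) (V : GaugeField (i.1.1.P i.1.2.1) 0 (Matrix.specialUnitaryGroup (Fin 2) ℂ))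
      (U₀ W : GaugeField (i.1.1.P i.1.2.2) 0 (Matrix.specialUnitaryGroup (Fin 2) ℂ)),
      0 < ε₁ → ε₁ ≤ a₁'' → PlaqSmall ε₁ V → (L : ℝ) ^ 3 * B₃ * ε₁ ≤ e → e ≤ e₅ →
      RegPr i.1.1 i.1.2.1 i.1.2.2 ((L : ℝ) ^ 3 * B₃ * ε₁) U₀ → CloseAvg i.1.1 i.1.2.1 i.1.2.2 i.2.2.le ((L : ℝ) ^ 3 * ε₁) V U₀ →
      W ∈ regFibrePr i.1.1 i.1.2.1 i.1.2.2 i.2.2.le e V → IsCritR2 i.1.1 i.1.2.1 i.1.2.2 i.2.2.le V W →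
        IsMinOn (fun W' : GaugeField (i.1.1.P i.1.2.2) 0 (Matrix.specialUnitaryGroup (Fin 2) ℂ) => wilsonAction4 W')
          (regFibrePr i.1.1 i.1.2.1 i.1.2.2 i.2.2.le e V) W := by
  intro L hL B₃ hB₃
  refine stub_PV3E_of_fibrePointSlice ?_ L hL B₃ hB₃
  intro L' hL'
  obtain ⟨e₆, sQ, ζ, δ₁, he₆, he₆L, hsQ0, hsQ8, hsQL, hζ, hδ0, hδκ, hwin1, hwin2, hE1, hS3⟩ := hrows L' hL'
  refine ⟨e₆, sQ, ζ, δ₁, he₆, he₆L, hsQ0, hsQ8, hsQL, hζ, hδ0, hδκ, hwin1, hwin2, ?_⟩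
  intro F hF n K hnK e V W he hhe hW hWcrit W' hW'
  obtain ⟨Y, hY, hAY, hsup, hSH⟩ := hE1 F hF n K hnK e V W he hhe hW hWcrit W' hW'
  exact ⟨Y, hY, hAY, hsup, fun D hD => hS3 F hF n K hnK e V W he hhe hW hWcrit Y hY hsup hSH D hD⟩

end Summit.QuantumFields.YangMills.Theorems.Prop7PV3EOfPinnedSliceAndZetaRow

end
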